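import Summits.CriticalPhenomena.PercolationContinuityZ3.Theorems.PercNearOneGluingNoHeavyQuantFarSunLaw
import HarnessLib

/-!
# FAR beyond trees: the SUN-LAW DICTIONARY VI — ARC SUMS: the probability that two / three given tips of the sun graph are all reached,
# in closed form (prim-quant-p1 g17's (S2) = (D2)–(D4) of `FOR-PROVERS-TWOARC-BRIDGE.md`)

builds on p205010 (kernel theorem, internal audit signed; external expert review pending)

Support file (`--supports stmt-CriticalPhenomena-4575`), seat `prim-cert-1` (gen 20); QUANT lane rung R8, front "FAR beyond trees" (lead g22/g23).
For the sun graph `C_{K+1}` with cycle-edge weights `g` and hair weights `h` in `[0,1]` (`α = arcA g`, `β = arcB K g`, `c = α_{K+1}` = all cycle edges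
open; hair index `k` sits at position `k+1`):

* `sunLaw_pair` — **`P(t_j and t_k reached) = h j · h k · (α_{k+1} + β_{j+1} + α_{j+1}β_{k+1} − 2c)`** (`j < k < K`), i.e.
  `sunLaw K g h (fun R => j ∈ R ∧ k ∈ R)` in closed form;
* `sunLaw_triple` — **`P(t_j, t_k, t_m reached) = h j · h k · h m · (α_{m+1} + β_{j+1} + α_{k+1}β_{m+1} + α_{j+1}β_{k+1} − 3c)`** (`j < k < m < K`);
* `sunLaw_one_pair`, `sunLaw_one_triple` — the hair-free ARC SUMS (`h ≡ 1`).
(The single tip is `sunLaw_mem_eq_sunMarg`: `h k · (α_{k+1} + β_{k+1} − c)`.)  PROOF (the SLOT DECOMPOSITION, g15 §8 / bridge spec §3): all tips of `S`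
are reached iff their hairs are open and the "hole" of uncovered positions (between the first and the last closed cycle edge) lies in one of
the `|S|+1` slots between consecutive positions of `S`; slot `t` is the cylinder "cw arc to the position before the slot and ccw arc from the
position after it both open" minus "everything open", these events pairwise meet only in "everything open", so
`P = c·∏h + Σ_slots (α·β·∏h − c·∏h)` (`measureReal_biUnion_core`); the cylinders are `real_hairs_and_cyc_open`.
No sorries; standard axioms.  [cite: Grimmett1999, §1.3 p. 10; §2.2] (product measure, cylinder probabilities); [this work].
-/

noncomputable section

namespace Summit.CriticalPhenomena.PercolationContinuityZ3.Theorems.HairyCycle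

open Finset MeasureTheory
open Literature.Probability.Percolation Literature.Probability.LatticeModels
open Summit.CriticalPhenomena.PercolationContinuityZ3.Theorems.AdditiveGluing.Negative.Cert
open Summit.CriticalPhenomena.PercolationContinuityZ3.Theorems.TwoCopy
open scoped Classical

variable {K : ℕ}

/-! ## A union whose members pairwise meet in a common core -/

/-- **Union over a common core**: if every `E t` (`t ∈ T ≠ ∅`) contains `A` and any two distinct ones meet inside `A`, then
`μ(⋃_{t∈T} E t) = μ(A) + Σ_{t∈T} (μ(E t) − μ(A))`. [folklore] -/
theorem measureReal_biUnion_core {Ω : Type*} [MeasurableSpace Ω] (μ : Measure Ω) [IsFiniteMeasure μ] {τ : Type*} (T : Finset τ)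
    (hT : T.Nonempty) (E : τ → Set Ω) (A : Set Ω) (hA : ∀ t ∈ T, A ⊆ E t) (hd : ∀ t ∈ T, ∀ t' ∈ T, t ≠ t' → E t ∩ E t' ⊆ A)
    (hmE : ∀ t ∈ T, MeasurableSet (E t)) (hmA : MeasurableSet A) :
    μ.real (⋃ t ∈ T, E t) = μ.real A + ∑ t ∈ T, (μ.real (E t) - μ.real A) := by
  have hunion : (⋃ t ∈ T, E t) = A ∪ ⋃ t ∈ T, (E t \ A) := by
    ext ω
    simp only [Set.mem_iUnion, Set.mem_union, Set.mem_sdiff, exists_prop]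
    constructor
    · rintro ⟨t, ht, hω⟩
      by_cases hωA : ω ∈ A
      · exact Or.inl hωA
      · exact Or.inr ⟨t, ht, hω, hωA⟩
    · rintro (hωA | ⟨t, ht, hω, -⟩)
      · obtain ⟨t, ht⟩ := hT
        exact ⟨t, ht, hA t ht hωA⟩
      · exact ⟨t, ht, hω⟩
  have hdisjA : Disjoint A (⋃ t ∈ T, (E t \ A)) := by
    rw [Set.disjoint_left]
    intro ω hωA hω
    simp only [Set.mem_iUnion, Set.mem_sdiff, exists_prop] at hω
    obtain ⟨t, -, -, hωA'⟩ := hω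
    exact hωA' hωA
  have hpd : (T : Set τ).PairwiseDisjoint fun t => E t \ A := by
    intro t ht t' ht' htt'
    rw [Function.onFun, Set.disjoint_left]
    rintro ω ⟨hω, hωA⟩ ⟨hω', -⟩
    exact hωA (hd t ht t' ht' htt' ⟨hω, hω'⟩)
  rw [hunion, measureReal_union hdisjA (MeasurableSet.biUnion (Finset.countable_toSet T) fun t ht => (hmE t ht).diff hmA)
      (measure_ne_top _ _) (measure_ne_top _ _),
    measureReal_biUnion_finset hpd fun t ht => (hmE t ht).diff hmA]
  congr 1
  exact Finset.sum_congr rfl fun t ht => measureReal_sdiff (hA t ht) hmA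

/-! ## Cylinders: a set of hairs and a set of cycle edges open -/

/-- **Hairs `S` and cycle edges `F` all open with probability `∏_S h · ∏_F g`** (cylinder). [this work] -/
theorem real_hairs_and_cyc_open (hK : 2 ≤ K) (q : Sym2 (Fin (2 * K + 1)) → unitInterval) {S : Finset ℕ} (hS : S ⊆ range K)
    {F : Finset ℕ} (hF : F ⊆ range (K + 1)) :
    (prodBernoulli q).real {ω | (∀ k ∈ S, hairE (sunCyc K) sunBase (sunTip K) k ∈ ω) ∧ ∀ m ∈ F, cycE (K + 1) (sunCyc K) m ∈ ω} =
      (∏ k ∈ S, sunH K q k) * ∏ m ∈ F, sunG K q m := by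
  have HS := isHairyCycle_sun hK
  set hE : ℕ → Sym2 (Fin (2 * K + 1)) := hairE (sunCyc K) sunBase (sunTip K) with hhE
  set cE : ℕ → Sym2 (Fin (2 * K + 1)) := cycE (K + 1) (sunCyc K) with hcE
  have hset : {ω : Set (Sym2 (Fin (2 * K + 1))) | (∀ k ∈ S, hE k ∈ ω) ∧ ∀ m ∈ F, cE m ∈ ω} =
      {ω | ((S.image hE ∪ F.image cE : Finset _) : Set (Sym2 (Fin (2 * K + 1)))) ⊆ ω} := by
    ext ω
    simp only [Set.mem_setOf_eq, Finset.coe_union, Finset.coe_image, Set.union_subset_iff, Set.image_subset_iff]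
    constructor
    · rintro ⟨h1, h2⟩; exact ⟨fun k hk => h1 k hk, fun m hm => h2 m hm⟩
    · rintro ⟨h1, h2⟩; exact ⟨fun k hk => h1 hk, fun m hm => h2 hm⟩
  have hdisj : Disjoint (S.image hE) (F.image cE) := by
    rw [Finset.disjoint_left]
    intro e he he'
    rw [Finset.mem_image] at he he'
    obtain ⟨k, hk, rfl⟩ := he
    obtain ⟨m, hm, hmk⟩ := he'
    exact hairE_ne_cycE HS (Finset.mem_range.1 (hS hk)) (Finset.mem_range.1 (hF hm)) hmk.symm
  have hinjh : Set.InjOn hE S := fun k hk k' hk' h =>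
    hairE_inj HS (Finset.mem_range.1 (hS hk)) (Finset.mem_range.1 (hS hk')) h
  have hinjc : Set.InjOn cE F := fun m hm m' hm' h =>
    cycE_inj HS (Finset.mem_range.1 (hF hm)) (Finset.mem_range.1 (hF hm')) h
  rw [hset, prodBernoulli_real_subset, Finset.prod_union hdisj, Finset.prod_image hinjh, Finset.prod_image hinjc]
  rfl

/-- `arcA` of the read-off weights. [this work] -/
theorem arcA_congr {g g' : ℕ → ℝ} (hg : ∀ m, m ≤ K → g m = g' m) {i : ℕ} (hi : i ≤ K + 1) : arcA g i = arcA g' i :=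
  Finset.prod_congr rfl fun m hm => hg m (by rw [Finset.mem_range] at hm; omega)

/-- `arcB` of the read-off weights. [this work] -/
theorem arcB_congr {g g' : ℕ → ℝ} (hg : ∀ m, m ≤ K → g m = g' m) (i : ℕ) : arcB K g i = arcB K g' i :=
  Finset.prod_congr rfl fun m hm => hg m (by rw [Finset.mem_Ico] at hm; omega)

/-! ## Two tips -/

/-- **ARC SUM OF A PAIR**: `P(t_j, t_k reached) = h j · h k · (α_{k+1} + β_{j+1} + α_{j+1} β_{k+1} − 2 α_{K+1})` for `j < k < K`,
i.e. `sunLaw K g h (fun R => j ∈ R ∧ k ∈ R)` in closed form (`g, h ∈ [0,1]`). [this work] -/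
theorem sunLaw_pair (hK : 2 ≤ K) {g h : ℕ → ℝ} (hg : ∀ m, m ≤ K → 0 ≤ g m ∧ g m ≤ 1) (hh : ∀ k, k < K → 0 ≤ h k ∧ h k ≤ 1)
    {j k : ℕ} (hjk : j < k) (hk : k < K) :
    sunLaw K g h (fun R => j ∈ R ∧ k ∈ R) =
      h j * h k * (arcA g (k + 1) + arcB K g (j + 1) + arcA g (j + 1) * arcB K g (k + 1) - 2 * arcA g (K + 1)) := by
  have hj : j < K := hjk.trans hk
  have HS := isHairyCycle_sun hK
  obtain ⟨q, hq, hqg, hqh⟩ := exists_sun_weight hK g h hg hh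
  rw [← sunLaw_congr hqg hqh, ← real_sun_reached_eq hK q hq]
  set μ := prodBernoulli q with hμ
  have hmeas : ∀ X : Set (Set (Sym2 (Fin (2 * K + 1)))), MeasurableSet X := fun _ => MeasurableSet.of_discrete
  set hE : ℕ → Sym2 (Fin (2 * K + 1)) := hairE (sunCyc K) sunBase (sunTip K) with hhE
  set cE : ℕ → Sym2 (Fin (2 * K + 1)) := cycE (K + 1) (sunCyc K) with hcE
  -- the slot cylinders (hairs `j, k` open, and the hole in slot `t`)
  set Fs : ℕ → Finset ℕ := fun t =>
    if t = 0 then range (k + 1) else if t = 1 then Ico (j + 1) (K + 1) else range (j + 1) ∪ Ico (k + 1) (K + 1) with hFs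
  set E : ℕ → Set (Set (Sym2 (Fin (2 * K + 1)))) := fun t =>
    {ω | (∀ i ∈ ({j, k} : Finset ℕ), hE i ∈ ω) ∧ ∀ m ∈ Fs t, cE m ∈ ω} with hEdef
  set A : Set (Set (Sym2 (Fin (2 * K + 1)))) := {ω | (∀ i ∈ ({j, k} : Finset ℕ), hE i ∈ ω) ∧ ∀ m ∈ range (K + 1), cE m ∈ ω} with hA
  have hjkS : ({j, k} : Finset ℕ) ⊆ range K := by
    intro i hi
    rw [Finset.mem_insert, Finset.mem_singleton] at hi
    rw [Finset.mem_range]; omega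
  have hFs_sub : ∀ t, Fs t ⊆ range (K + 1) := by
    intro t m hm
    simp only [hFs] at hm
    rw [Finset.mem_range]
    split_ifs at hm with h1 h2
    · rw [Finset.mem_range] at hm; omega
    · rw [Finset.mem_Ico] at hm; omega
    · rw [Finset.mem_union, Finset.mem_range, Finset.mem_Ico] at hm; omega
  -- the event, almost surely
  have hev : μ.real {ω | (fun R => j ∈ R ∧ k ∈ R) ((range K).filter fun i => ω ∈ openConn (sunCyc K 0) (sunTip K i))} =
      μ.real (⋃ t ∈ range 3, E t) := by
    refine real_congr_of_good q fun ω hω => ?_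
    have hC := carried_of_good q hq hω
    have hrt : ∀ i, i < K → (ω ∈ openConn (sunCyc K 0) (sunTip K i) ↔ RT (K + 1) (sunCyc K) sunBase (sunTip K) ω i) := fun i hi =>
      mem_openConn_tip_iff (K + 1) (sunCyc K) K sunBase (sunTip K) HS.hL HS.hcyc HS.hbase HS.htip HS.hoff ω hC hi
    simp only [Set.mem_setOf_eq, Finset.mem_filter, Finset.mem_range, Set.mem_iUnion, exists_prop, hrt j hj, hrt k hk]
    unfold RT RC CW CCW sunBase
    simp only [hEdef, Set.mem_setOf_eq, Finset.mem_insert, Finset.mem_singleton, forall_eq_or_imp, forall_eq, hFs]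
    constructor
    · rintro ⟨⟨hj', hRCj, hhj⟩, hk', hRCk, hhk⟩
      rcases hRCk with hcw | hccw
      · exact ⟨0, by norm_num, ⟨hhj, hhk⟩, fun m hm => by
          simp only [if_true] at hm; exact hcw m (Finset.mem_range.1 hm)⟩
      · rcases hRCj with hcwj | hccwj
        · refine ⟨2, by norm_num, ⟨hhj, hhk⟩, fun m hm => ?_⟩
          simp only [show (2 : ℕ) ≠ 0 from by norm_num, show (2 : ℕ) ≠ 1 from by norm_num, if_false,
            Finset.mem_union, Finset.mem_range, Finset.mem_Ico] at hm
          rcases hm with hm | hm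
          · exact hcwj m hm
          · exact hccw m hm.1 hm.2
        · refine ⟨1, by norm_num, ⟨hhj, hhk⟩, fun m hm => ?_⟩
          simp only [show (1 : ℕ) ≠ 0 from by norm_num, if_false, if_true, Finset.mem_Ico] at hm
          exact hccwj m hm.1 hm.2
    · rintro ⟨t, ht, ⟨hhj, hhk⟩, hcyc⟩
      have ht3 : t = 0 ∨ t = 1 ∨ t = 2 := by omega
      rcases ht3 with rfl | rfl | rfl
      · simp only [if_true] at hcyc
        have hcw : ∀ m, m < k + 1 → cE m ∈ ω := fun m hm => hcyc m (Finset.mem_range.2 hm)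
        exact ⟨⟨hj, Or.inl fun m hm => hcw m (by omega), hhj⟩, hk, Or.inl hcw, hhk⟩
      · simp only [show (1 : ℕ) ≠ 0 from by norm_num, if_false, if_true] at hcyc
        have hccw : ∀ m, j + 1 ≤ m → m < K + 1 → cE m ∈ ω := fun m h1 h2 => hcyc m (Finset.mem_Ico.2 ⟨h1, h2⟩)
        exact ⟨⟨hj, Or.inr hccw, hhj⟩, hk, Or.inr fun m h1 h2 => hccw m (by omega) h2, hhk⟩
      · simp only [show (2 : ℕ) ≠ 0 from by norm_num, show (2 : ℕ) ≠ 1 from by norm_num, if_false] at hcyc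
        refine ⟨⟨hj, Or.inl fun m hm => hcyc m (Finset.mem_union_left _ (Finset.mem_range.2 hm)), hhj⟩, hk,
          Or.inr fun m h1 h2 => hcyc m (Finset.mem_union_right _ (Finset.mem_Ico.2 ⟨h1, h2⟩)), hhk⟩
  rw [hev]
  -- the union over the common core `A` (everything open)
  have hcore : ∀ t ∈ range 3, A ⊆ E t := by
    intro t _ ω hω
    exact ⟨hω.1, fun m hm => hω.2 m (hFs_sub t hm)⟩
  have hmeet : ∀ t ∈ range 3, ∀ t' ∈ range 3, t ≠ t' → E t ∩ E t' ⊆ A := by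
    intro t ht t' ht' htt' ω hω
    obtain ⟨⟨hh1, h1⟩, ⟨-, h2⟩⟩ := hω
    refine ⟨hh1, fun m hm => ?_⟩
    rw [Finset.mem_range] at hm ht ht'
    -- every cycle edge lies in `Fs t ∪ Fs t'` for `t ≠ t'`
    have key : m ∈ Fs t ∨ m ∈ Fs t' := by
      simp only [hFs]
      interval_cases t <;> interval_cases t' <;>
        simp only [if_true, if_false, show (1 : ℕ) ≠ 0 from by norm_num, show (2 : ℕ) ≠ 0 from by norm_num,
          show (2 : ℕ) ≠ 1 from by norm_num, Finset.mem_range, Finset.mem_Ico, Finset.mem_union] <;> omega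
    rcases key with hm' | hm'
    · exact h1 m hm'
    · exact h2 m hm'
  rw [measureReal_biUnion_core μ (range 3) ⟨0, by simp⟩ E A hcore hmeet (fun _ _ => hmeas _) (hmeas _)]
  -- evaluate the cylinders
  have hA_eq : μ.real A = h j * h k * arcA g (K + 1) := by
    rw [hA, real_hairs_and_cyc_open hK q hjkS (subset_refl _), Finset.prod_pair hjk.ne, hqh j hj, hqh k hk,
      ← arcA_congr hqg le_rfl]
    rfl
  have hE_eq : ∀ t, μ.real (E t) = h j * h k * ∏ m ∈ Fs t, sunG K q m := by
    intro t
    rw [hEdef, real_hairs_and_cyc_open hK q hjkS (hFs_sub t), Finset.prod_pair hjk.ne, hqh j hj, hqh k hk]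
  have hF0 : ∏ m ∈ Fs 0, sunG K q m = arcA g (k + 1) := by
    simp only [hFs, if_true]; rw [← arcA_congr hqg (by omega)]; rfl
  have hF1 : ∏ m ∈ Fs 1, sunG K q m = arcB K g (j + 1) := by
    simp only [hFs, show (1 : ℕ) ≠ 0 from by norm_num, if_false, if_true]; rw [← arcB_congr hqg]; rfl
  have hF2 : ∏ m ∈ Fs 2, sunG K q m = arcA g (j + 1) * arcB K g (k + 1) := by
    simp only [hFs, show (2 : ℕ) ≠ 0 from by norm_num, show (2 : ℕ) ≠ 1 from by norm_num, if_false]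
    have hd : Disjoint (range (j + 1)) (Ico (k + 1) (K + 1)) := Finset.disjoint_left.2 fun m h1 h2 => by
      rw [Finset.mem_range] at h1; rw [Finset.mem_Ico] at h2; omega
    rw [Finset.prod_union hd, ← arcA_congr hqg (by omega), ← arcB_congr hqg]; rfl
  rw [Finset.sum_range_succ, Finset.sum_range_succ, Finset.sum_range_one, hE_eq 0, hE_eq 1, hE_eq 2, hF0, hF1, hF2, hA_eq]
  ring

/-- **Hair-free arc sum of a pair**: `sunLaw K g 1 (fun R => j ∈ R ∧ k ∈ R) = α_{k+1} + β_{j+1} + α_{j+1}β_{k+1} − 2α_{K+1}` (`j < k < K`). [this work] -/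
theorem sunLaw_one_pair (hK : 2 ≤ K) {g : ℕ → ℝ} (hg : ∀ m, m ≤ K → 0 ≤ g m ∧ g m ≤ 1) {j k : ℕ} (hjk : j < k) (hk : k < K) :
    sunLaw K g (fun _ => (1 : ℝ)) (fun R => j ∈ R ∧ k ∈ R) =
      arcA g (k + 1) + arcB K g (j + 1) + arcA g (j + 1) * arcB K g (k + 1) - 2 * arcA g (K + 1) := by
  rw [sunLaw_pair hK hg (fun _ _ => ⟨zero_le_one, le_rfl⟩) hjk hk]
  ring

/-! ## Three tips -/

/-- **ARC SUM OF A TRIPLE**: `P(t_j, t_k, t_m reached) = h j · h k · h m · (α_{m+1} + β_{j+1} + α_{k+1} β_{m+1} + α_{j+1} β_{k+1} − 3 α_{K+1})`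
for `j < k < m < K` (`g, h ∈ [0,1]`). [this work] -/
theorem sunLaw_triple (hK : 2 ≤ K) {g h : ℕ → ℝ} (hg : ∀ m, m ≤ K → 0 ≤ g m ∧ g m ≤ 1) (hh : ∀ k, k < K → 0 ≤ h k ∧ h k ≤ 1)
    {j k m : ℕ} (hjk : j < k) (hkm : k < m) (hm : m < K) :
    sunLaw K g h (fun R => j ∈ R ∧ k ∈ R ∧ m ∈ R) =
      h j * h k * h m * (arcA g (m + 1) + arcB K g (j + 1) + arcA g (k + 1) * arcB K g (m + 1) +
        arcA g (j + 1) * arcB K g (k + 1) - 3 * arcA g (K + 1)) := by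
  have hk : k < K := hkm.trans hm
  have hj : j < K := hjk.trans hk
  have HS := isHairyCycle_sun hK
  obtain ⟨q, hq, hqg, hqh⟩ := exists_sun_weight hK g h hg hh
  rw [← sunLaw_congr hqg hqh, ← real_sun_reached_eq hK q hq]
  set μ := prodBernoulli q with hμ
  have hmeas : ∀ X : Set (Set (Sym2 (Fin (2 * K + 1)))), MeasurableSet X := fun _ => MeasurableSet.of_discrete
  set hE : ℕ → Sym2 (Fin (2 * K + 1)) := hairE (sunCyc K) sunBase (sunTip K) with hhE
  set cE : ℕ → Sym2 (Fin (2 * K + 1)) := cycE (K + 1) (sunCyc K) with hcE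
  set Fs : ℕ → Finset ℕ := fun t =>
    if t = 0 then range (m + 1) else if t = 1 then Ico (j + 1) (K + 1)
    else if t = 2 then range (k + 1) ∪ Ico (m + 1) (K + 1) else range (j + 1) ∪ Ico (k + 1) (K + 1) with hFs
  set E : ℕ → Set (Set (Sym2 (Fin (2 * K + 1)))) := fun t =>
    {ω | (∀ i ∈ ({j, k, m} : Finset ℕ), hE i ∈ ω) ∧ ∀ n ∈ Fs t, cE n ∈ ω} with hEdef
  set A : Set (Set (Sym2 (Fin (2 * K + 1)))) :=
    {ω | (∀ i ∈ ({j, k, m} : Finset ℕ), hE i ∈ ω) ∧ ∀ n ∈ range (K + 1), cE n ∈ ω} with hA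
  have hS : ({j, k, m} : Finset ℕ) ⊆ range K := by
    intro i hi
    rw [Finset.mem_insert, Finset.mem_insert, Finset.mem_singleton] at hi
    rw [Finset.mem_range]; omega
  have hFs_sub : ∀ t, Fs t ⊆ range (K + 1) := by
    intro t n hn
    simp only [hFs] at hn
    rw [Finset.mem_range]
    split_ifs at hn with h1 h2 h3
    · rw [Finset.mem_range] at hn; omega
    · rw [Finset.mem_Ico] at hn; omega
    · rw [Finset.mem_union, Finset.mem_range, Finset.mem_Ico] at hn; omega
    · rw [Finset.mem_union, Finset.mem_range, Finset.mem_Ico] at hn; omega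
  have hprod : ∏ i ∈ ({j, k, m} : Finset ℕ), sunH K q i = h j * h k * h m := by
    rw [Finset.prod_insert (by rw [Finset.mem_insert, Finset.mem_singleton]; omega), Finset.prod_pair hkm.ne,
      hqh j hj, hqh k hk, hqh m hm]
    ring
  -- the event, almost surely
  have hev : μ.real {ω | (fun R => j ∈ R ∧ k ∈ R ∧ m ∈ R) ((range K).filter fun i => ω ∈ openConn (sunCyc K 0) (sunTip K i))} =
      μ.real (⋃ t ∈ range 4, E t) := by
    refine real_congr_of_good q fun ω hω => ?_
    have hC := carried_of_good q hq hω
    have hrt : ∀ i, i < K → (ω ∈ openConn (sunCyc K 0) (sunTip K i) ↔ RT (K + 1) (sunCyc K) sunBase (sunTip K) ω i) := fun i hi =>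
      mem_openConn_tip_iff (K + 1) (sunCyc K) K sunBase (sunTip K) HS.hL HS.hcyc HS.hbase HS.htip HS.hoff ω hC hi
    simp only [Set.mem_setOf_eq, Finset.mem_filter, Finset.mem_range, Set.mem_iUnion, exists_prop, hrt j hj, hrt k hk, hrt m hm]
    unfold RT RC CW CCW sunBase
    simp only [hEdef, Set.mem_setOf_eq, Finset.mem_insert, Finset.mem_singleton, forall_eq_or_imp, forall_eq, hFs]
    constructor
    · rintro ⟨⟨-, hRCj, hhj⟩, ⟨-, hRCk, hhk⟩, -, hRCm, hhm⟩
      rcases hRCm with hcwm | hccwm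
      · exact ⟨0, by norm_num, ⟨hhj, hhk, hhm⟩, fun n hn => by
          simp only [if_true] at hn; exact hcwm n (Finset.mem_range.1 hn)⟩
      · rcases hRCk with hcwk | hccwk
        · refine ⟨2, by norm_num, ⟨hhj, hhk, hhm⟩, fun n hn => ?_⟩
          simp only [show (2 : ℕ) ≠ 0 from by norm_num, show (2 : ℕ) ≠ 1 from by norm_num, if_false, if_true,
            Finset.mem_union, Finset.mem_range, Finset.mem_Ico] at hn
          rcases hn with hn | hn
          · exact hcwk n hn
          · exact hccwm n hn.1 hn.2
        · rcases hRCj with hcwj | hccwj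
          · refine ⟨3, by norm_num, ⟨hhj, hhk, hhm⟩, fun n hn => ?_⟩
            simp only [show (3 : ℕ) ≠ 0 from by norm_num, show (3 : ℕ) ≠ 1 from by norm_num, show (3 : ℕ) ≠ 2 from by norm_num,
              if_false, Finset.mem_union, Finset.mem_range, Finset.mem_Ico] at hn
            rcases hn with hn | hn
            · exact hcwj n hn
            · exact hccwk n hn.1 hn.2
          · refine ⟨1, by norm_num, ⟨hhj, hhk, hhm⟩, fun n hn => ?_⟩
            simp only [show (1 : ℕ) ≠ 0 from by norm_num, if_false, if_true, Finset.mem_Ico] at hn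
            exact hccwj n hn.1 hn.2
    · rintro ⟨t, ht, ⟨hhj, hhk, hhm⟩, hcyc⟩
      have ht4 : t = 0 ∨ t = 1 ∨ t = 2 ∨ t = 3 := by omega
      rcases ht4 with rfl | rfl | rfl | rfl
      · simp only [if_true] at hcyc
        have hcw : ∀ n, n < m + 1 → cE n ∈ ω := fun n hn => hcyc n (Finset.mem_range.2 hn)
        exact ⟨⟨hj, Or.inl fun n hn => hcw n (by omega), hhj⟩, ⟨hk, Or.inl fun n hn => hcw n (by omega), hhk⟩,
          hm, Or.inl hcw, hhm⟩
      · simp only [show (1 : ℕ) ≠ 0 from by norm_num, if_false, if_true] at hcyc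
        have hccw : ∀ n, j + 1 ≤ n → n < K + 1 → cE n ∈ ω := fun n h1 h2 => hcyc n (Finset.mem_Ico.2 ⟨h1, h2⟩)
        exact ⟨⟨hj, Or.inr hccw, hhj⟩, ⟨hk, Or.inr fun n h1 h2 => hccw n (by omega) h2, hhk⟩,
          hm, Or.inr fun n h1 h2 => hccw n (by omega) h2, hhm⟩
      · simp only [show (2 : ℕ) ≠ 0 from by norm_num, show (2 : ℕ) ≠ 1 from by norm_num, if_false, if_true] at hcyc
        have hcw : ∀ n, n < k + 1 → cE n ∈ ω := fun n hn => hcyc n (Finset.mem_union_left _ (Finset.mem_range.2 hn))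
        have hccw : ∀ n, m + 1 ≤ n → n < K + 1 → cE n ∈ ω := fun n h1 h2 =>
          hcyc n (Finset.mem_union_right _ (Finset.mem_Ico.2 ⟨h1, h2⟩))
        exact ⟨⟨hj, Or.inl fun n hn => hcw n (by omega), hhj⟩, ⟨hk, Or.inl hcw, hhk⟩, hm, Or.inr hccw, hhm⟩
      · simp only [show (3 : ℕ) ≠ 0 from by norm_num, show (3 : ℕ) ≠ 1 from by norm_num, show (3 : ℕ) ≠ 2 from by norm_num,
          if_false] at hcyc
        have hcw : ∀ n, n < j + 1 → cE n ∈ ω := fun n hn => hcyc n (Finset.mem_union_left _ (Finset.mem_range.2 hn))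
        have hccw : ∀ n, k + 1 ≤ n → n < K + 1 → cE n ∈ ω := fun n h1 h2 =>
          hcyc n (Finset.mem_union_right _ (Finset.mem_Ico.2 ⟨h1, h2⟩))
        exact ⟨⟨hj, Or.inl hcw, hhj⟩, ⟨hk, Or.inr hccw, hhk⟩, hm, Or.inr fun n h1 h2 => hccw n (by omega) h2, hhm⟩
  rw [hev]
  have hcore : ∀ t ∈ range 4, A ⊆ E t := by
    intro t _ ω hω
    exact ⟨hω.1, fun n hn => hω.2 n (hFs_sub t hn)⟩
  have hmeet : ∀ t ∈ range 4, ∀ t' ∈ range 4, t ≠ t' → E t ∩ E t' ⊆ A := by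
    intro t ht t' ht' htt' ω hω
    obtain ⟨⟨hh1, h1⟩, ⟨-, h2⟩⟩ := hω
    refine ⟨hh1, fun n hn => ?_⟩
    rw [Finset.mem_range] at hn ht ht'
    have key : n ∈ Fs t ∨ n ∈ Fs t' := by
      simp only [hFs]
      interval_cases t <;> interval_cases t' <;>
        simp only [if_true, if_false, show (1 : ℕ) ≠ 0 from by norm_num, show (2 : ℕ) ≠ 0 from by norm_num,
          show (2 : ℕ) ≠ 1 from by norm_num, show (3 : ℕ) ≠ 0 from by norm_num, show (3 : ℕ) ≠ 1 from by norm_num,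
          show (3 : ℕ) ≠ 2 from by norm_num, Finset.mem_range, Finset.mem_Ico, Finset.mem_union] <;> omega
    rcases key with hn' | hn'
    · exact h1 n hn'
    · exact h2 n hn'
  rw [measureReal_biUnion_core μ (range 4) ⟨0, by simp⟩ E A hcore hmeet (fun _ _ => hmeas _) (hmeas _)]
  have hA_eq : μ.real A = h j * h k * h m * arcA g (K + 1) := by
    rw [hA, real_hairs_and_cyc_open hK q hS (subset_refl _), hprod, ← arcA_congr hqg le_rfl]
    rfl
  have hE_eq : ∀ t, μ.real (E t) = h j * h k * h m * ∏ n ∈ Fs t, sunG K q n := by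
    intro t
    rw [hEdef, real_hairs_and_cyc_open hK q hS (hFs_sub t), hprod]
  have hF0 : ∏ n ∈ Fs 0, sunG K q n = arcA g (m + 1) := by
    simp only [hFs, if_true]; rw [← arcA_congr hqg (by omega)]; rfl
  have hF1 : ∏ n ∈ Fs 1, sunG K q n = arcB K g (j + 1) := by
    simp only [hFs, show (1 : ℕ) ≠ 0 from by norm_num, if_false, if_true]; rw [← arcB_congr hqg]; rfl
  have hF2 : ∏ n ∈ Fs 2, sunG K q n = arcA g (k + 1) * arcB K g (m + 1) := by
    simp only [hFs, show (2 : ℕ) ≠ 0 from by norm_num, show (2 : ℕ) ≠ 1 from by norm_num, if_false, if_true]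
    have hd : Disjoint (range (k + 1)) (Ico (m + 1) (K + 1)) := Finset.disjoint_left.2 fun n h1 h2 => by
      rw [Finset.mem_range] at h1; rw [Finset.mem_Ico] at h2; omega
    rw [Finset.prod_union hd, ← arcA_congr hqg (by omega), ← arcB_congr hqg]; rfl
  have hF3 : ∏ n ∈ Fs 3, sunG K q n = arcA g (j + 1) * arcB K g (k + 1) := by
    simp only [hFs, show (3 : ℕ) ≠ 0 from by norm_num, show (3 : ℕ) ≠ 1 from by norm_num, show (3 : ℕ) ≠ 2 from by norm_num, if_false]
    have hd : Disjoint (range (j + 1)) (Ico (k + 1) (K + 1)) := Finset.disjoint_left.2 fun n h1 h2 => by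
      rw [Finset.mem_range] at h1; rw [Finset.mem_Ico] at h2; omega
    rw [Finset.prod_union hd, ← arcA_congr hqg (by omega), ← arcB_congr hqg]; rfl
  rw [Finset.sum_range_succ, Finset.sum_range_succ, Finset.sum_range_succ, Finset.sum_range_one,
    hE_eq 0, hE_eq 1, hE_eq 2, hE_eq 3, hF0, hF1, hF2, hF3, hA_eq]
  ring

/-- **Hair-free arc sum of a triple**: `sunLaw K g 1 (j ∈ · ∧ k ∈ · ∧ m ∈ ·) = α_{m+1} + β_{j+1} + α_{k+1}β_{m+1} + α_{j+1}β_{k+1} − 3α_{K+1}`. [this work] -/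
theorem sunLaw_one_triple (hK : 2 ≤ K) {g : ℕ → ℝ} (hg : ∀ n, n ≤ K → 0 ≤ g n ∧ g n ≤ 1) {j k m : ℕ}
    (hjk : j < k) (hkm : k < m) (hm : m < K) :
    sunLaw K g (fun _ => (1 : ℝ)) (fun R => j ∈ R ∧ k ∈ R ∧ m ∈ R) =
      arcA g (m + 1) + arcB K g (j + 1) + arcA g (k + 1) * arcB K g (m + 1) + arcA g (j + 1) * arcB K g (k + 1) - 3 * arcA g (K + 1) := by
  rw [sunLaw_triple hK hg (fun _ _ => ⟨zero_le_one, le_rfl⟩) hjk hkm hm]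
  ring

end Summit.CriticalPhenomena.PercolationContinuityZ3.Theorems.HairyCycle

end
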